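import Mathlib
import Summits.CriticalPhenomena.CardyFormulaZ2.Theorems.CardySelfRefinementDefs
import Summits.CriticalPhenomena.CardyFormulaZ2.Theorems.CardySelfRefinementRussoDriftModel
import Summits.CriticalPhenomena.CardyFormulaZ2.Theorems.CardySelfRefinementTrivialSectorRateStubFourArmAboveOneCircuitBitsHarris
import Literature.Probability.Percolation.CrossingClusterBlockEstimate
import Literature.Probability.Percolation.FourArmGarbanHolds
import Literature.Probability.Percolation.SelfRefinementMeasure
import HarnessLib

/-!
# Helper (M4a), part 3, of stub `stub_fourArmAboveOne`, line `far-field-is-a-quarter-turn`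
(crux `TrivialSectorRate`, stmt-CriticalPhenomena-10266): the separation-free BLOCK ESTIMATE
`E[Z w_j] ≥ M_k(four arms)` for the dependent model `M_k`

Component (B.2)+(B.4) of the Garban scheme data `hS` of the percolation-free reduction
`fourArmAboveOneAlong_of_garbanScheme` (file `…StubFourArmAboveOneReduction.lean`), for the
self-refinement law `M_k(ρ,c₀)`: with `Z = numCrossingClusters · N R` (van den Berg–Nolin's number
of open clusters of `B(R)` joining `B(N)` to `‖·‖_∞ = R`), a centre `j`, the hole `j + B(h)` inside
the circuit annulus `j + A_{a',b'}` (`h + 2 ≤ a' ≤ b'`, `j + B(b'+1) ⊆ B(N)`, `b' + 2 + |j i| ≤ R`),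
the block `j + B(b'+1)` ALIGNED with `kℤ²` (`k ∣ j i ± (b'+1)`), and the re-weighted circuit bit
`w = 1_Δ/pΔ − 1_O/pO` (`O`, `Δ` the open / closed-dual circuit events of the annulus, of positive
`M_k`-probabilities `pO`, `pΔ`):

`M_k(ρ,c₀)(fourArmTwoClustersAt j h n) ≤ ∫ Z w dM_k(ρ,c₀)`  (`n ≥ R + |j i|`)

(`M_real_fourArmTwoClustersAt_le_integral_mul_weight`, registered helper).  The proof is the tree's
`le_integral_mul_circuitWeight` (`CrossingClusterBlockEstimate.lean`) run for `M_k`: the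
deterministic facts (on `O` and on `Δ` the hole is not pivotal for `Z`; on the four-arm event
opening the hole merges two crossing clusters; `Z` is antitone in the edges of `B(N)`) hold on
lattice configurations, which carry `M_k` (`selfRefinementMeasure_ae_subset_edgeSet`), and the two
Harris steps `E[Z 1_O] = E[Z⁺ 1_O] ≤ pO E[Z⁺]`, `E[Z 1_Δ] = E[Z⁻ 1_Δ] ≥ pΔ E[Z⁻]` are Harris
inside the ALIGNED block given the outside for `M_k` (`M_integral_mul_indicator_le_of_aligned`,
`M_real_mul_integral_le_of_aligned`, file `…StubFourArmAboveOneCircuitBitsHarris.lean`).  Also the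
mean-zero property of `w` under `M_k` (`M_integral_circuitWeight_obs`).

What remains of the separation input `hsep` of `hS` after this file: (B.5) `E[Z w] = E[Z w ; hole
pivotal]` and (B.7) "pivotal blocks are examined by an explorer whose examined blocks carry two arms"
with the explorer's revealment/orthogonality identities, for `M_k` on the coin space.

References: O. Schramm, S. Smirnov (app. C. Garban), Ann. Probab. 39 (2011), App. B, proof of
Lemma B.1, (B.2)–(B.5); J. van den Berg, P. Nolin, Progr. Probab. 77 (2020), §5.2.

Target file:
`Summits/CriticalPhenomena/CardyFormulaZ2/Theorems/CardySelfRefinementTrivialSectorRateStubFourArmAboveOneCircuitBits.lean`.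
-/

noncomputable section

namespace Summit.CriticalPhenomena.CardyFormulaZ2.Theorems.CardySelfRefinement.FarField

open Set MeasureTheory ProbabilityTheory
open Literature.Probability.LatticeModels Literature.Probability.Percolation
open Literature.Probability.Percolation.QuadCrossing
open Summit.CriticalPhenomena.CardyFormulaZ2.Theses.CardySelfRefinement

/-! ### The block estimate `E[Z w] ≥ M_k(four arms)` for the dependent model -/

/-- **The separation-free block estimate for `M_k`** (registered helper of the stub
`stub_fourArmAboveOne`; the `M_k`-analogue of the tree's `le_integral_mul_circuitWeight`,
Garban's (B.2)+(B.4) with van den Berg–Nolin's cluster count and the pivotal hole inside the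
circuit annulus).  Fix `0 < k`, `N < R`, a centre `j`, a hole radius `h ≥ 1` and annulus radii
`h + 2 ≤ a' ≤ b'` with `j + B(b'+1) ⊆ B(N)`, `b' + 2 + |j i| ≤ R`, a four-arm outer radius
`n ≥ R + |j i|`, and assume the block `j + B(b'+1)` is ALIGNED with the coarse lattice `kℤ²`
(`k ∣ j i ± (b'+1)`).  Let `O = openCircuitInAnnulusAt j a' b'`, `Δ = dualCircuitInAnnulusAt j a' b'`
have positive `M_k(ρ,c₀)`-probabilities `pO`, `pΔ`, and `w = 1_Δ/pΔ - 1_O/pO`.  Then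
`M_k(ρ,c₀)(fourArmTwoClustersAt j h n) ≤ ∫ Z w dM_k(ρ,c₀)` for `Z = numCrossingClusters · N R`:
on `O` and on `Δ` the hole is not pivotal (deterministic, on lattice configurations, which carry
`M_k`), Harris inside the aligned block given the outside (`M_integral_mul_indicator_le_of_aligned`,
`M_real_mul_integral_le_of_aligned`) gives `E[Z 1_Δ] ≥ pΔ E[Z⁻]`, `E[Z 1_O] ≤ pO E[Z⁺]`, and
`Z⁻ - Z⁺ ≥ 1` on the four-arm event. -/
theorem M_real_fourArmTwoClustersAt_le_integral_mul_weight {k : ℕ} (hk : 0 < k) (ρ c₀ : ℝ)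
    {N R : ℕ} (hNR : N < R) {j : Site 2} {h a' b' n : ℕ} (hh : 1 ≤ h) (hha : h + 2 ≤ a')
    (hab : a' ≤ b') (hV : ∀ x, x - j ∈ box 2 (b' + 1) → x ∈ box 2 N)
    (hb : ∀ i, (b' : ℤ) + 2 + |j i| ≤ R) (hn : ∀ i, (R : ℤ) + |j i| ≤ n)
    (hal : ∀ i, (k : ℤ) ∣ j i - ((b' + 1 : ℕ) : ℤ) ∧ (k : ℤ) ∣ j i + ((b' + 1 : ℕ) : ℤ))
    {pO pD : ℝ} (hpO : pO = (M k ρ c₀).real (openCircuitInAnnulusAt j a' b')) (hpO0 : 0 < pO)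
    (hpD : pD = (M k ρ c₀).real (dualCircuitInAnnulusAt j a' b')) (hpD0 : 0 < pD) :
    (M k ρ c₀).real (fourArmTwoClustersAt j h n) ≤
      ∫ ω, (numCrossingClusters ω N R : ℝ) *
        ((dualCircuitInAnnulusAt j a' b').indicator 1 ω / pD -
          (openCircuitInAnnulusAt j a' b').indicator 1 ω / pO) ∂(M k ρ c₀) := by
  haveI := isProbabilityMeasure_M k ρ c₀
  set O := openCircuitInAnnulusAt j a' b' with hOdef
  set D := dualCircuitInAnnulusAt j a' b' with hDdef
  set H : Finset (Sym2 (Site 2)) := blockPairs j h with hHdef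
  set T : Finset (Sym2 (Site 2)) := blockPairs j (b' + 1) with hTdef
  set Z : BondConfig (Site 2) → ℝ := fun ω => (numCrossingClusters ω N R : ℝ) with hZ
  set gp : BondConfig (Site 2) → ℕ := fun ω => numCrossingClusters (ω \ ↑H ∪ ↑H) N R with hgp
  set gm : BondConfig (Site 2) → ℕ := fun ω => numCrossingClusters (ω \ ↑H ∪ ∅) N R with hgm
  set Zp : BondConfig (Site 2) → ℝ := fun ω => (gp ω : ℝ) with hZp
  set Zm : BondConfig (Site 2) → ℝ := fun ω => (gm ω : ℝ) with hZm
  have ha : 1 ≤ a' := by omega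
  have hVh : ∀ x, x - j ∈ box 2 h → x ∈ box 2 N := fun x hx => hV x (box_mono 2 (by omega) hx)
  have hHN : (↑H : Set (Sym2 (Site 2))) ⊆ ↑(boxEdges N) := blockPairs_subset_boxEdges hVh
  have hTN : (↑T : Set (Sym2 (Site 2))) ⊆ ↑(boxEdges N) := blockPairs_subset_boxEdges hV
  -- measurability and bounds
  have hOm : MeasurableSet O := measurableSet_openCircuitInAnnulusAt j a' b'
  have hDm : MeasurableSet D := measurableSet_dualCircuitInAnnulusAt j a' b'
  have hZmeas : Measurable Z := measurable_numCrossingClusters_real N R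
  have hZpm : Measurable Zp := measurable_numCrossingClusters_sdiff_union N R H ↑H
  have hZmm : Measurable Zm := measurable_numCrossingClusters_sdiff_union N R H ∅
  have hgpK : ∀ ω, gp ω ≤ (box 2 N).card := fun ω => numCrossingClusters_le_card _ N R
  have hgmK : ∀ ω, gm ω ≤ (box 2 N).card := fun ω => numCrossingClusters_le_card _ N R
  set K : ℝ := ((box 2 N).card : ℝ) with hK
  have hbound : ∀ ω' : BondConfig (Site 2), |(numCrossingClusters ω' N R : ℝ)| ≤ K := fun ω' => by
    rw [Nat.abs_cast, hK]; exact_mod_cast numCrossingClusters_le_card ω' N R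
  have hZb : ∀ ω, |Z ω| ≤ K := fun ω => hbound ω
  have hZpb : ∀ ω, |Zp ω| ≤ K := fun ω => hbound _
  have hZmb : ∀ ω, |Zm ω| ≤ K := fun ω => hbound _
  have hint : ∀ {g : BondConfig (Site 2) → ℝ}, Measurable g → (∀ ω, |g ω| ≤ K) → Integrable g (M k ρ c₀) :=
    fun hg hgb => Integrable.of_bound hg.aestronglyMeasurable K
      (ae_of_all _ fun ω => by rw [Real.norm_eq_abs]; exact hgb ω)
  have hintA : ∀ {g : BondConfig (Site 2) → ℝ} {A : Set (BondConfig (Site 2))}, Measurable g →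
      (∀ ω, |g ω| ≤ K) → MeasurableSet A → Integrable (fun ω => g ω * A.indicator 1 ω) (M k ρ c₀) := by
    intro g A hg hgb hAm
    refine Integrable.of_bound (hg.mul (measurable_one.indicator hAm)).aestronglyMeasurable K
      (ae_of_all _ fun ω => ?_)
    rw [Real.norm_eq_abs, abs_mul]
    by_cases hA : ω ∈ A
    · rw [Set.indicator_of_mem hA, Pi.one_apply, abs_one, mul_one]; exact hgb ω
    · rw [Set.indicator_of_notMem hA, abs_zero, mul_zero]; exact (abs_nonneg (g ω)).trans (hgb ω)
  -- pointwise: `Z⁺ ≤ Z ≤ Z⁻`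
  have hanti_union : ∀ ω' : BondConfig (Site 2),
      numCrossingClusters (ω' ∪ ↑H) N R ≤ numCrossingClusters ω' N R := fun ω' =>
    numCrossingClusters_anti (ω₁ := ω') (ω₂ := ω' ∪ ↑H) Set.subset_union_left (fun e he => by
      rcases he.1 with h1 | h1
      · exact absurd h1 he.2
      · exact hHN h1)
  have hanti_sdiff : ∀ ω' : BondConfig (Site 2),
      numCrossingClusters ω' N R ≤ numCrossingClusters (ω' \ ↑H) N R := fun ω' =>
    numCrossingClusters_anti (ω₁ := ω' \ ↑H) (ω₂ := ω') (fun e he => he.1) (fun e he => by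
      by_contra hN; exact he.2 ⟨he.1, fun hb => hN (hHN hb)⟩)
  have hpm : ∀ ω, Zp ω ≤ Zm ω := fun ω => by
    simp only [hZp, hZm, hgp, hgm, Set.union_empty, Set.sdiff_union_self]
    exact_mod_cast (hanti_union ω).trans (hanti_sdiff ω)
  have hZ_le_Zm : ∀ ω, Z ω ≤ Zm ω := fun ω => by
    simp only [hZ, hZm, hgm, Set.union_empty]
    exact_mod_cast hanti_sdiff ω
  have hZp_le_Z : ∀ ω, Zp ω ≤ Z ω := fun ω => by
    simp only [hZ, hZp, hgp, Set.sdiff_union_self]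
    exact_mod_cast hanti_union ω
  have hL : ∀ᵐ ω ∂(M k ρ c₀), ω ⊆ (zdGraph 2).edgeSet := selfRefinementMeasure_ae_subset_edgeSet k ρ c₀
  -- (i), (ii): on `O` resp. `Δ` (lattice configurations) `Z⁺ = Z⁻`, hence `Z = Z⁺ = Z⁻`
  have hOD_eq : ∀ ω, ω ⊆ (zdGraph 2).edgeSet → (ω ∈ O ∨ ω ∈ D) → Zp ω = Zm ω := by
    intro ω hω hOD
    simp only [hZp, hZm, hgp, hgm, Set.sdiff_union_self, Set.union_empty]
    rcases hOD with hωO | hωD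
    · exact_mod_cast numCrossingClusters_union_eq_sdiff_of_mem_openCircuitInAnnulusAt hω hNR ha hab
        (by omega) hV hωO
    · exact_mod_cast numCrossingClusters_union_eq_sdiff_of_mem_dualCircuitInAnnulusAt hω hNR ha hab hha
        hVh hb hωD
  have hOeq : ∀ᵐ ω ∂(M k ρ c₀), Z ω * O.indicator 1 ω = Zp ω * O.indicator 1 ω := by
    filter_upwards [hL] with ω hω
    by_cases hωO : ω ∈ O
    · have h1 := hOD_eq ω hω (Or.inl hωO)
      have h2 := hZp_le_Z ω
      have h3 := hZ_le_Zm ω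
      have : Z ω = Zp ω := by linarith
      rw [this]
    · simp [Set.indicator_of_notMem hωO]
  have hDeq : ∀ᵐ ω ∂(M k ρ c₀), Z ω * D.indicator 1 ω = Zm ω * D.indicator 1 ω := by
    filter_upwards [hL] with ω hω
    by_cases hωD : ω ∈ D
    · have h1 := hOD_eq ω hω (Or.inr hωD)
      have h2 := hZp_le_Z ω
      have h3 := hZ_le_Zm ω
      have : Z ω = Zm ω := by linarith
      rw [this]
    · simp [Set.indicator_of_notMem hωD]
  -- the circuit events are determined by `T`
  have hsub : blockPairs j b' ⊆ T := fun e he =>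
    mem_blockPairs_iff.2 fun v hv => box_mono 2 (Nat.le_succ _) (mem_blockPairs_iff.1 he v hv)
  have hOT : DeterminedBy O (↑T : Set (Sym2 (Site 2))) :=
    (determinedBy_openCircuitInAnnulusAt j a' b').mono (Finset.coe_subset.2 hsub)
  have hDT : DeterminedBy D (↑T : Set (Sym2 (Site 2))) :=
    (determinedBy_dualCircuitInAnnulusAt j a' b').mono (dualEdge_preimage_blockPairs_subset j b')
  -- antitonicity of `Z⁺`, `Z⁻` inside `T`
  have hanti : ∀ (ξ₀ : Set (Sym2 (Site 2))) (ω : BondConfig (Site 2)) (ξ ξ' : Set (Sym2 (Site 2))),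
      ξ ⊆ ξ' → ξ' ⊆ ↑T →
      numCrossingClusters ((ω \ ↑T ∪ ξ') \ ↑H ∪ ξ₀) N R ≤
        numCrossingClusters ((ω \ ↑T ∪ ξ) \ ↑H ∪ ξ₀) N R := by
    intro ξ₀ ω ξ ξ' h1 h2
    exact numCrossingClusters_anti (N := N) (M := R) (ω₁ := (ω \ ↑T ∪ ξ) \ ↑H ∪ ξ₀)
      (ω₂ := (ω \ ↑T ∪ ξ') \ ↑H ∪ ξ₀)
      (fun e he => by
        rcases he with ⟨he1, he2⟩ | he1
        · rcases he1 with he1 | he1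
          · exact Or.inl ⟨Or.inl he1, he2⟩
          · exact Or.inl ⟨Or.inr (h1 he1), he2⟩
        · exact Or.inr he1)
      (fun e he => by
        have h' : e ∈ ξ' := by
          rcases he.1 with ⟨he1, he2⟩ | he1
          · rcases he1 with he1 | he1
            · exact absurd (Or.inl ⟨Or.inl he1, he2⟩) he.2
            · exact he1
          · exact absurd (Or.inr he1) he.2
        exact hTN (h2 h'))
  -- Harris inside the aligned block `T`, given the outside
  have hHO : ∫ ω, Zp ω * O.indicator 1 ω ∂(M k ρ c₀) ≤ (M k ρ c₀).real O * ∫ ω, Zp ω ∂(M k ρ c₀) :=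
    M_integral_mul_indicator_le_of_aligned hk ρ c₀ hal (g := gp) hZpm hgpK
      (fun ω ξ ξ' h1 h2 => hanti _ ω ξ ξ' h1 h2) (isUpperSet_openCircuitInAnnulusAt j a' b') hOm hOT
  have hHD : (M k ρ c₀).real D * ∫ ω, Zm ω ∂(M k ρ c₀) ≤ ∫ ω, Zm ω * D.indicator 1 ω ∂(M k ρ c₀) :=
    M_real_mul_integral_le_of_aligned hk ρ c₀ hal (g := gm) hZmm hgmK
      (fun ω ξ ξ' h1 h2 => hanti _ ω ξ ξ' h1 h2) (isLowerSet_dualCircuitInAnnulusAt j a' b') hDm hDT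
  rw [← hpO] at hHO
  rw [← hpD] at hHD
  -- the linear combination
  have hIO : ∫ ω, Z ω * O.indicator 1 ω ∂(M k ρ c₀) = ∫ ω, Zp ω * O.indicator 1 ω ∂(M k ρ c₀) :=
    integral_congr_ae hOeq
  have hID : ∫ ω, Z ω * D.indicator 1 ω ∂(M k ρ c₀) = ∫ ω, Zm ω * D.indicator 1 ω ∂(M k ρ c₀) :=
    integral_congr_ae hDeq
  have hsplit : ∫ ω, Z ω * (D.indicator 1 ω / pD - O.indicator 1 ω / pO) ∂(M k ρ c₀) =
      (1 / pD) * ∫ ω, Z ω * D.indicator 1 ω ∂(M k ρ c₀) - (1 / pO) * ∫ ω, Z ω * O.indicator 1 ω ∂(M k ρ c₀) := by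
    have hpt : ∀ ω, Z ω * (D.indicator 1 ω / pD - O.indicator 1 ω / pO) =
        (1 / pD) * (Z ω * D.indicator 1 ω) - (1 / pO) * (Z ω * O.indicator 1 ω) := fun ω => by ring
    simp_rw [hpt]
    rw [integral_sub ((hintA hZmeas hZb hDm).const_mul _) ((hintA hZmeas hZb hOm).const_mul _),
      integral_const_mul, integral_const_mul]
  -- the pivotality event and the four arms
  have hSm : MeasurableSet {ω : BondConfig (Site 2) | Zp ω + 1 ≤ Zm ω} :=
    measurableSet_le (hZpm.add_const 1) hZmm
  have hF : (M k ρ c₀).real (fourArmTwoClustersAt j h n) ≤ (M k ρ c₀).real {ω | Zp ω + 1 ≤ Zm ω} := by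
    have hae : fourArmTwoClustersAt j h n ≤ᵐ[M k ρ c₀] {ω | Zp ω + 1 ≤ Zm ω} := by
      filter_upwards [hL] with ω hω h4
      show Zp ω + 1 ≤ Zm ω
      simp only [hZp, hZm, hgp, hgm, Set.sdiff_union_self, Set.union_empty]
      exact_mod_cast numCrossingClusters_union_lt_sdiff_of_mem_fourArmTwoClustersAt hω hNR hh hVh hn h4
    simp only [measureReal_def]
    exact ENNReal.toReal_mono (measure_ne_top _ _) (measure_mono_ae hae)
  have hind : (M k ρ c₀).real {ω | Zp ω + 1 ≤ Zm ω} ≤ ∫ ω, (Zm ω - Zp ω) ∂(M k ρ c₀) := by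
    rw [← integral_indicator_one hSm]
    refine integral_mono ((integrable_const (1 : ℝ)).indicator hSm) ((hint hZmm hZmb).sub (hint hZpm hZpb))
      fun ω => ?_
    simp only [Set.indicator_apply, Set.mem_setOf_eq, Pi.one_apply]
    split_ifs with hω
    · linarith
    · linarith [hpm ω]
  rw [integral_sub (hint hZmm hZmb) (hint hZpm hZpb)] at hind
  -- assemble
  rw [hsplit, hIO, hID]
  have h1 : ∫ ω, Zm ω ∂(M k ρ c₀) ≤ (1 / pD) * ∫ ω, Zm ω * D.indicator 1 ω ∂(M k ρ c₀) := by
    rw [one_div, ← div_eq_inv_mul, le_div_iff₀ hpD0, mul_comm]; exact hHD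
  have h2 : (1 / pO) * ∫ ω, Zp ω * O.indicator 1 ω ∂(M k ρ c₀) ≤ ∫ ω, Zp ω ∂(M k ρ c₀) := by
    rw [one_div, ← div_eq_inv_mul, div_le_iff₀ hpO0, mul_comm]; exact hHO
  linarith

/-! ### The re-weighted circuit bit has mean zero under `M_k` -/

/-- **The re-weighted circuit bit `w = 1_Δ/pΔ − 1_O/pO` read off the block has mean zero under
`M_k(ρ,c₀)`** when `pO`, `pΔ` are the actual (positive) `M_k`-probabilities of the circuit events
(the `M_k`-analogue of the tree's `integral_circuitWeight_obs`; Garban's (B.3) `E[C_j] = 0` without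
self-duality). -/
theorem M_integral_circuitWeight_obs (k : ℕ) (ρ c₀ : ℝ) {j : Site 2} {a' b' : ℕ} {pO pD : ℝ}
    (hpO : pO = (M k ρ c₀).real (openCircuitInAnnulusAt j a' b')) (hpO0 : 0 < pO)
    (hpD : pD = (M k ρ c₀).real (dualCircuitInAnnulusAt j a' b')) (hpD0 : 0 < pD) :
    ∫ ω, circuitWeight j a' b' pO pD (obs ω (blockPairs j (b' + 1))) ∂(M k ρ c₀) = 0 := by
  haveI := isProbabilityMeasure_M k ρ c₀
  simp_rw [circuitWeight_obs]
  have hOm := measurableSet_openCircuitInAnnulusAt j a' b'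
  have hDm := measurableSet_dualCircuitInAnnulusAt j a' b'
  have hint : ∀ {A : Set (BondConfig (Site 2))}, MeasurableSet A → ∀ c : ℝ,
      Integrable (fun ω => A.indicator (1 : BondConfig (Site 2) → ℝ) ω / c) (M k ρ c₀) :=
    fun hA c => ((integrable_const (1 : ℝ)).indicator hA).div_const c
  rw [integral_sub (hint hDm pD) (hint hOm pO), integral_div, integral_div, integral_indicator_one hDm,
    integral_indicator_one hOm, ← hpO, ← hpD, div_self hpD0.ne', div_self hpO0.ne', sub_self]

end Summit.CriticalPhenomena.CardyFormulaZ2.Theorems.CardySelfRefinement.FarField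

end
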